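import Literature.NumberTheory.Automorphic.SmoothIndTransport                 -- ★ `SmoothInd.transportEquiv`, `rootDeltaChar_transport`
import Literature.NumberTheory.Automorphic.IrreducibleClassesConstituents     -- ★ `IrrClass.isConstituentOf_congr` (+ `IrrClass.comap_isConstituentOf_comp_iff`)
import Literature.NumberTheory.Automorphic.IrreducibleClassesComapInner       -- ★ `IrrClass.comap`, `comap_eq_comap_of_forall_eq_conj`
import Literature.NumberTheory.Automorphic.CMPrincipalSeriesSpherical          -- ★ `val_proj_borelTriple` (the Levi projection of `B ⊂ U(Φ_N)` reads off the diagonal); brings `cmPrincipalSeries`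
import Literature.NumberTheory.Automorphic.LocalUnitaryGroupCongrInner         -- ★ `conjLocal_eq_self_of_formCongr_eq_smul_antidiag` (a similitude multiplier is conjugation-fixed)
import Summits.HodgeConjecture.HodgeConjecture.Theorems.R90S4InnerSimilFixesClass  -- ★ (R90-C131-p03) `comap_cmDatumLocalCongr_eq_of_eq_norm_mul` (same multiplier ⇒ same pull-back)
import HarnessLib

/-!
# R90-TF · S4 «Ch. 13.1–2» — socket S4#B5 `stub_R90_S4_H_lds`, input (STAB) PROVED: the similitude action of `GU(Φ₂)` on
# `E(U(Φ₂)(L⁺_v))` permutes the constituents of every principal series `i_G(χ)`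

Cell `hodgecm-mathlib`, crux H413 (`stmt-HodgeConjecture-24833`, lane `--supports … --as helper`), route of record `HCCMUnconditional`
(no route verbs; count-neutral).  Programme R90-TF (HUMAN RULING «R90-TF SLAB — MAX PUSH»; brief `director/R90-BRIEF.v2.md`
1f40d54518340a35), section S4 = Rogawski Ch. 13.1–2 (base `R90-C131`); seat R90-C131-p05 (g0), dealt BY NAME «p05 → S4#B5
`stub_R90_S4_H_lds` — ROAD KEYS U(2): two constituents swapped by an outer similitude (census-first)» (`R90/S4/DEAL-S4-WAVE1.K2E2-plan-g6.md`).
THEOREMS ONLY (no `def`, no instance, no notation, no named fact, no `sorry`); imports ★ only.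

THE POINT.  Socket S4#B5 (`Cruxes/H413/Lines/R90_S4_HPacketsU2B.lean` :360) says that at a non-split `v` the constituents of
`i_{U(Φ₂)}((χ₁, χ₂))`, `χ₁|F^× = ω_{E/F}`, form ONE L-packet of `U(Φ₂)(L⁺_v)` with two elements — an L-packet being «by definition, a
`PGL₂(F)`-orbit in `E(G)`» [Rogawski1990, §11.1 p. 161], realised in the tree by conjugation by local SIMILITUDES `T ∈ GL₂(L ⊗ L⁺_v)`,
`ᵗT̄ Φ₂ T = a Φ₂` (★ `cmDatumLocalCongr`, ★ `IrrClass.comap`).  The census cut of that socket (this seat's `Theorems/R90S4HLdsOfKeys.lean`)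
has three inputs: (STAB) the similitude action PERMUTES `JH(i_G(χ))`; (TWO) `i_G(χ)` has exactly two constituents [Keys]; (ORBIT) they are
similitude-conjugate [Keys ∕ Labesse–Langlands].  This file PROVES (STAB), for every character `χ` of the diagonal torus:

* §1 (generic, any topological group `G`, any parabolic triple `t = (P, M, N)`, any `σ`): an automorphism `φ : G ≃ₜ* G` with `φ(P) = P`
  and `σ(proj(φ p)) = σ(proj p)` on `P` gives `i_P^G σ ≅ (i_P^G σ) ∘ φ` (`nonempty_normalizedInd_equiv_comp`: the map `f ↦ f ∘ φ⁻¹` of ★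
  `SmoothInd.transportEquiv`; `δ_P^{1/2} ∘ φ = δ_P^{1/2}` by ★ `rootDeltaChar_transport`), hence `JH(i_P^G σ)` is `comap φ`-stable
  (`isConstituentOf_comap_normalizedInd`, ★ `IrrClass.comap_isConstituentOf_comp_iff` + ★ `IrrClass.isConstituentOf_congr`);
* §2 (matrix algebra) the entries of `D g D⁻¹` for a diagonal frame `D = diag(d)`; diagonal conjugation preserves upper-triangularity;
* §3 (`G = U(Φ_N)(L⁺_v)`, any `N`) an automorphism acting as `Ad(D)`, `D` diagonal, preserves the Borel `B` (`mem_cmBorel_iff_of_coe_eq_diag_conj`),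
  commutes with the Levi projection (`proj_cmBorel_eq_of_coe_eq_diag_conj`, via ★ `val_proj_borelTriple`) and therefore preserves
  `JH(i_G(χ))` for `i_G(χ) = cmPrincipalSeries L N v χ` (`isConstituentOf_comap_cmPrincipalSeries_of_coe_eq_diag_conj`;
  `cmPrincipalSeries_eq_normalizedInd` records ★ `cmPrincipalSeries` ≝ ★ `normalizedInd` of the Borel triple);
* §4 (`N = 2`) `D = diag(a, 1)` is a similitude of `Φ₂` with multiplier `a` for `ā = a` (`formCongr_glDiagonal_two_eq_smul`); every
  similitude `T` has conjugation-fixed multiplier (★ `conjLocal_eq_self_of_formCongr_eq_smul_antidiag`) and pulls back classes exactly as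
  `diag(a, 1)` does (★ `comap_cmDatumLocalCongr_eq_of_eq_norm_mul`, R90-C131-p03: `T = u · diag(a, 1)`, `u ∈ U(Φ₂)(L⁺_v)`, and inner
  automorphisms fix classes); whence the HEADLINE **`isConstituentOf_comap_cmDatumLocalCongr_cmPrincipalSeries`**: for every local
  similitude `(T, a)` of `Φ₂` and every constituent `c` of `cmPrincipalSeries L 2 v χ`, `IrrClass.comap (cmDatumLocalCongr L v T ha h) c`
  is a constituent of `cmPrincipalSeries L 2 v χ` — hypothesis `hStab` of `R90.S4.lds_of_stable_of_two_of_orbit` TOKEN FOR TOKEN.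

Searched before proving (2026-09-04): `lean search` for `normalizedInd.*comap|principalSeries.*conj|transportEquiv` consumers in
`Automorphic/` — the transport ★ `SmoothIndTransport` had no principal-series consumer; nothing restated (★ decls cited by name above).

HONEST LABEL: HC_CM is proved only modulo the 7 printed citations (2 remaining named inputs: hLiu418 = stmt-HodgeConjecture-24832,
h413 = stmt-HodgeConjecture-24833) until rung 0 closes; this file is local representation theory of `U(Φ_N)(L⁺_v)` and discharges none of
them by itself.  REL ≠ ★ ≠ BUILT.

## References
* [Rogawski1990] J. D. Rogawski, *Automorphic Representations of Unitary Groups in Three Variables*, Ann. of Math. Stud. 123 (1990), §1.10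
  p. 9 (`B`, `M`, `N`), §11.1 p. 161 («an L-packet on `U(2)` is a `PGL₂(F)`-orbit in `E(G)`»), §12.1 p. 171, §12.2 p. 173 (`i_G(χ)`).
* [BernsteinZelevinsky1977] I. N. Bernstein, A. V. Zelevinsky, *Induced representations of reductive 𝔭-adic groups I*, Ann. Sci. ÉNS 10
  (1977), §1.8 (Levi decomposition), §2.3 (normalised induction and its functoriality).
* [BushnellHenniart2006] C. J. Bushnell, G. Henniart, *The Local Langlands Conjecture for GL(2)*, Grundlehren 335 (2006), §1.1–§2.
* [PlatonovRapinchuk1994] V. Platonov, A. Rapinchuk, *Algebraic Groups and Number Theory* (1994), §2.3 (similitudes, unitary groups).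
-/

set_option autoImplicit false
set_option linter.dupNamespace false

noncomputable section

open Literature.NumberTheory.Automorphic

namespace Summit.HodgeConjecture.HodgeConjecture.R90.S4

universe u

section Generic

variable {G : Type u} [Group G] [TopologicalSpace G] [IsTopologicalGroup G]

/-- **Normalised induction is equivariantly self-equivalent along an automorphism preserving the parabolic and the
inducing data.**  For a parabolic triple `t = (P, M, N)` of `G`, a representation `σ` of `M`, and an automorphism
`φ : G ≃ₜ* G` of topological groups with `φ(P) = P` and `σ(proj(φ p)) = σ(proj p)` on `P`, the map `f ↦ f ∘ φ⁻¹` is an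
isomorphism `i_P^G σ ≅ (i_P^G σ) ∘ φ` of representations of `G` (★ `SmoothInd.transportEquiv`; the modulus `δ_P^{1/2}` is
`φ`-invariant by ★ `rootDeltaChar_transport`). [cite: BernsteinZelevinsky1977, §2.3] [cite: BushnellHenniart2006, §1.1] -/
theorem nonempty_normalizedInd_equiv_comp (t : ParabolicTriple G) [LocallyCompactSpace t.P]
    {W : Type*} [AddCommGroup W] [Module ℂ W] (σ : Representation ℂ t.M W)
    (φ : G ≃ₜ* G) (hP : ∀ x, φ x ∈ t.P ↔ x ∈ t.P)
    (hσ : ∀ p : t.P, σ (t.proj ⟨φ p, (hP p).2 p.2⟩) = σ (t.proj p)) :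
    Nonempty ((Representation.normalizedInd t σ).Equiv
      ((Representation.normalizedInd t σ).comp ((φ : G ≃* G) : G →* G))) := by
  have hφ : Continuous (φ : G ≃* G) := φ.continuous
  have hφ' : Continuous (φ : G ≃* G).symm := φ.symm.continuous
  -- the inducing representation `σ ∘ proj ⊗ δ_P^{1/2}` is `φ`-invariant on `P`
  have hind : ∀ x : t.P, Representation.twist (σ.comp t.proj) (rootDeltaChar t.P) x =
      Representation.twist (σ.comp t.proj) (rootDeltaChar t.P) ⟨(φ : G ≃* G) x, (hP x).2 x.2⟩ := by
    intro x
    apply LinearMap.ext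
    intro w
    rw [Representation.twist_apply, Representation.twist_apply, MonoidHom.comp_apply, MonoidHom.comp_apply,
      Representation.rootDeltaChar_transport (φ : G ≃* G) hφ hφ' hP x,
      show σ (t.proj ⟨(φ : G ≃* G) x, (hP x).2 x.2⟩) = σ (t.proj x) from hσ x]
  refine ⟨Representation.Equiv.mk
    (Representation.SmoothInd.transportEquiv (φ : G ≃* G) hφ hφ' hP hind) fun g => LinearMap.ext fun f => ?_⟩
  exact Representation.SmoothInd.transportEquiv_smoothIndRep (φ : G ≃* G) hφ hφ' hP hind g f

/-- **Constituents of `i_P^G σ` are stable under pull-back along such an automorphism**: with the data above, if `c` is a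
constituent of `i_P^G σ` then so is `c ∘ φ` (★ `IrrClass.comap_isConstituentOf_comp_iff` + the equivalence above).
[cite: BernsteinZelevinsky1977, §2.3] [cite: BushnellHenniart2006, §1.1–§2] -/
theorem isConstituentOf_comap_normalizedInd (t : ParabolicTriple G) [LocallyCompactSpace t.P]
    {W : Type*} [AddCommGroup W] [Module ℂ W] (σ : Representation ℂ t.M W)
    (φ : G ≃ₜ* G) (hP : ∀ x, φ x ∈ t.P ↔ x ∈ t.P)
    (hσ : ∀ p : t.P, σ (t.proj ⟨φ p, (hP p).2 p.2⟩) = σ (t.proj p))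
    {c : IrrClass G} (hc : c.IsConstituentOf (Representation.normalizedInd t σ)) :
    (IrrClass.comap φ c).IsConstituentOf (Representation.normalizedInd t σ) := by
  obtain ⟨e⟩ := nonempty_normalizedInd_equiv_comp t σ φ hP hσ
  exact (IrrClass.isConstituentOf_congr e _).2 ((IrrClass.comap_isConstituentOf_comp_iff φ _ c).2 hc)

end Generic

/-! ## §2 The entries of `D g D⁻¹` for a diagonal frame `D` -/

section Diagonal

variable {R : Type*} [CommRing R] {n : ℕ}

/-- `(D g D⁻¹)_{ij} = d_i · g_{ij} · d_j⁻¹` for `D = diag(d)`. [folklore] [cite: PlatonovRapinchuk1994, §2.3] -/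
theorem val_glDiagonal_mul_mul_inv_apply (d : Fin n → Rˣ) (g : GL (Fin n) R) (i j : Fin n) :
    ((glDiagonal n R d * g * (glDiagonal n R d)⁻¹ : GL (Fin n) R) : Matrix (Fin n) (Fin n) R) i j =
      (d i : R) * (g : Matrix (Fin n) (Fin n) R) i j * (((d j)⁻¹ : Rˣ) : R) := by
  rw [← map_inv, Units.val_mul, Units.val_mul, coe_glDiagonal, coe_glDiagonal, Matrix.mul_diagonal, Matrix.diagonal_mul,
    Pi.inv_apply]

/-- The diagonal entries of `D g D⁻¹` are those of `g`. [folklore] [cite: PlatonovRapinchuk1994, §2.3] -/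
theorem val_glDiagonal_mul_mul_inv_apply_self (d : Fin n → Rˣ) (g : GL (Fin n) R) (i : Fin n) :
    ((glDiagonal n R d * g * (glDiagonal n R d)⁻¹ : GL (Fin n) R) : Matrix (Fin n) (Fin n) R) i i =
      (g : Matrix (Fin n) (Fin n) R) i i := by
  rw [val_glDiagonal_mul_mul_inv_apply, mul_comm ((d i : Rˣ) : R), mul_assoc, Units.mul_inv, mul_one]

/-- Conjugation by a diagonal frame preserves upper-triangularity. [folklore] [cite: PlatonovRapinchuk1994, §2.3] -/
theorem blockTriangular_glDiagonal_mul_mul_inv_iff (d : Fin n → Rˣ) (g : GL (Fin n) R) :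
    ((glDiagonal n R d * g * (glDiagonal n R d)⁻¹ : GL (Fin n) R) : Matrix (Fin n) (Fin n) R).BlockTriangular id ↔
      (g : Matrix (Fin n) (Fin n) R).BlockTriangular id := by
  constructor
  · intro h i j hij
    have hz := h hij
    rw [val_glDiagonal_mul_mul_inv_apply] at hz
    exact ((d i).isUnit.mul_right_eq_zero).1 (((d j)⁻¹.isUnit.mul_left_eq_zero).1 hz)
  · intro h i j hij
    rw [val_glDiagonal_mul_mul_inv_apply, h hij, mul_zero, zero_mul]

end Diagonal

/-! ## §3 `G = U(Φ_N)(L⁺_v)`: an automorphism acting as `Ad(D)`, `D` diagonal, preserves `B`, the Levi projection and `JH(i_G(χ))` -/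

section CM

open NumberField IsDedekindDomain
open scoped MatrixGroups
open Literature.NumberTheory.Automorphic.UnitaryGroup

variable (L : Type) [Field L] [NumberField L] [IsCMField L] (v : HeightOneSpectrum (𝓞 ↥(maximalRealSubfield L)))

/-- **`cmPrincipalSeries L N v χ` IS the normalised induction `i_B^G(𝟙 ⊗ χ)` of the Borel triple** — a definitional
unfolding (★ `cmPrincipalSeries` ≝ ★ `principalSeries` ≝ ★ `Representation.normalizedInd`), recorded as a rewrite rule.
[cite: Rogawski1990, §12.2 p. 173] [cite: BernsteinZelevinsky1977, §2.3] -/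
theorem cmPrincipalSeries_eq_normalizedInd (N : ℕ) (χ : ↥(torusU (conjLocal L (IsCMField.complexConj L) v) (cmLocalForm L N v)) →* ℂˣ) :
    cmPrincipalSeries L N v χ =
      haveI := locallyCompactSpace_cmBorelU L N v
      Representation.normalizedInd (cmBorelTriple L N v) ((Representation.trivial ℂ ↥(torusU (conjLocal L (IsCMField.complexConj L) v) (cmLocalForm L N v)) ℂ).twist χ) :=
  rfl

/-- **An automorphism of `U(Φ_N)(L⁺_v)` acting as `Ad(D)` with `D` DIAGONAL preserves the Borel subgroup `B`** (upper
triangularity is invariant under diagonal conjugation, §2). [cite: Rogawski1990, §1.10 p. 9] [cite: PlatonovRapinchuk1994, §2.3] -/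
theorem mem_cmBorel_iff_of_coe_eq_diag_conj (N : ℕ) (e : ↥(unitaryGroupOfForm (conjLocal L (IsCMField.complexConj L) v) (cmLocalForm L N v)) ≃ₜ* ↥(unitaryGroupOfForm (conjLocal L (IsCMField.complexConj L) v) (cmLocalForm L N v))) (d : Fin N → (LocalRing L v)ˣ)
    (he : ∀ g : ↥(unitaryGroupOfForm (conjLocal L (IsCMField.complexConj L) v) (cmLocalForm L N v)), ((e g : ↥(unitaryGroupOfForm (conjLocal L (IsCMField.complexConj L) v) (cmLocalForm L N v))) : GL (Fin N) (LocalRing L v)) =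
      glDiagonal N (LocalRing L v) d * (g : GL (Fin N) (LocalRing L v)) * (glDiagonal N (LocalRing L v) d)⁻¹)
    (x : ↥(unitaryGroupOfForm (conjLocal L (IsCMField.complexConj L) v) (cmLocalForm L N v))) : e x ∈ (cmBorelTriple L N v).P ↔ x ∈ (cmBorelTriple L N v).P := by
  change (((e x : ↥(unitaryGroupOfForm (conjLocal L (IsCMField.complexConj L) v) (cmLocalForm L N v))) : GL (Fin N) (LocalRing L v)) : Matrix (Fin N) (Fin N) (LocalRing L v)).BlockTriangular id ↔
    ((x : GL (Fin N) (LocalRing L v)) : Matrix (Fin N) (Fin N) (LocalRing L v)).BlockTriangular id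
  rw [he x]
  exact blockTriangular_glDiagonal_mul_mul_inv_iff d _

/-- **… and commutes with the Levi projection `B → T`** (`proj` reads off the diagonal, ★ `val_proj_borelTriple`, and the diagonal of
`D p D⁻¹` is that of `p`). [cite: Rogawski1990, §1.10 p. 9] [cite: BernsteinZelevinsky1977, §1.8] -/
theorem proj_cmBorel_eq_of_coe_eq_diag_conj (N : ℕ) (e : ↥(unitaryGroupOfForm (conjLocal L (IsCMField.complexConj L) v) (cmLocalForm L N v)) ≃ₜ* ↥(unitaryGroupOfForm (conjLocal L (IsCMField.complexConj L) v) (cmLocalForm L N v))) (d : Fin N → (LocalRing L v)ˣ)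
    (he : ∀ g : ↥(unitaryGroupOfForm (conjLocal L (IsCMField.complexConj L) v) (cmLocalForm L N v)), ((e g : ↥(unitaryGroupOfForm (conjLocal L (IsCMField.complexConj L) v) (cmLocalForm L N v))) : GL (Fin N) (LocalRing L v)) =
      glDiagonal N (LocalRing L v) d * (g : GL (Fin N) (LocalRing L v)) * (glDiagonal N (LocalRing L v) d)⁻¹)
    (p : ↥(cmBorelTriple L N v).P) :
    (cmBorelTriple L N v).proj ⟨e (p : ↥(unitaryGroupOfForm (conjLocal L (IsCMField.complexConj L) v) (cmLocalForm L N v))), (mem_cmBorel_iff_of_coe_eq_diag_conj L v N e d he p).2 p.2⟩ =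
      (cmBorelTriple L N v).proj p := by
  apply Subtype.ext
  apply Subtype.ext
  apply Units.ext
  rw [val_proj_borelTriple, val_proj_borelTriple]
  refine congrArg Matrix.diagonal (funext fun i => ?_)
  change (((e (p : ↥(unitaryGroupOfForm (conjLocal L (IsCMField.complexConj L) v) (cmLocalForm L N v))) : ↥(unitaryGroupOfForm (conjLocal L (IsCMField.complexConj L) v) (cmLocalForm L N v))) : GL (Fin N) (LocalRing L v)) : Matrix (Fin N) (Fin N) (LocalRing L v)) i i = _
  rw [he]
  exact val_glDiagonal_mul_mul_inv_apply_self d _ i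

-- `maxHeartbeats 400000`: matching the Borel-triple data of ★ `cmPrincipalSeries` against the generic ★ `normalizedInd`
-- statement of §1 costs the elaborator ≈ 3·10⁵ heartbeats of definitional unfolding (no search, no `decide`).
set_option maxHeartbeats 400000 in
/-- **`JH(i_G(χ))` IS STABLE UNDER ANY AUTOMORPHISM ACTING AS A DIAGONAL CONJUGATION**: for `G = U(Φ_N)(L⁺_v)`, a character `χ`
of the diagonal torus and an automorphism `e` of topological groups of `G` with `e(g) = D g D⁻¹`, `D` diagonal (e.g. the outer
similitude `diag(a, 1)` of `U(Φ₂)`, `a ∈ F_v^×`), every constituent `c` of `i_G(χ) = cmPrincipalSeries L N v χ` has `c ∘ e` again a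
constituent: `e` fixes `B`, commutes with `proj` and preserves `δ_B^{1/2}`, so `i_G(χ) ∘ e ≅ i_G(χ)` (§1).
[cite: Rogawski1990, §11.1 p. 161; §12.1 p. 171] [cite: BernsteinZelevinsky1977, §2.3] -/
theorem isConstituentOf_comap_cmPrincipalSeries_of_coe_eq_diag_conj (N : ℕ) (χ : ↥(torusU (conjLocal L (IsCMField.complexConj L) v) (cmLocalForm L N v)) →* ℂˣ)
    (e : ↥(unitaryGroupOfForm (conjLocal L (IsCMField.complexConj L) v) (cmLocalForm L N v)) ≃ₜ* ↥(unitaryGroupOfForm (conjLocal L (IsCMField.complexConj L) v) (cmLocalForm L N v))) (d : Fin N → (LocalRing L v)ˣ)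
    (he : ∀ g : ↥(unitaryGroupOfForm (conjLocal L (IsCMField.complexConj L) v) (cmLocalForm L N v)), ((e g : ↥(unitaryGroupOfForm (conjLocal L (IsCMField.complexConj L) v) (cmLocalForm L N v))) : GL (Fin N) (LocalRing L v)) =
      glDiagonal N (LocalRing L v) d * (g : GL (Fin N) (LocalRing L v)) * (glDiagonal N (LocalRing L v) d)⁻¹)
    {c : IrrClass ↥(unitaryGroupOfForm (conjLocal L (IsCMField.complexConj L) v) (cmLocalForm L N v))} (hc : c.IsConstituentOf (cmPrincipalSeries L N v χ)) :
    (IrrClass.comap e c).IsConstituentOf (cmPrincipalSeries L N v χ) := by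
  -- the inducing character `𝟙 ⊗ χ` does not see the difference between `proj (e p)` and `proj p`
  have hσ : ∀ p : ↥(cmBorelTriple L N v).P,
      ((Representation.trivial ℂ ↥(torusU (conjLocal L (IsCMField.complexConj L) v) (cmLocalForm L N v)) ℂ).twist χ)
          ((cmBorelTriple L N v).proj ⟨e (p : ↥(unitaryGroupOfForm (conjLocal L (IsCMField.complexConj L) v) (cmLocalForm L N v))), (mem_cmBorel_iff_of_coe_eq_diag_conj L v N e d he p).2 p.2⟩) =
        ((Representation.trivial ℂ ↥(torusU (conjLocal L (IsCMField.complexConj L) v) (cmLocalForm L N v)) ℂ).twist χ) ((cmBorelTriple L N v).proj p) :=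
    fun p => congrArg _ (proj_cmBorel_eq_of_coe_eq_diag_conj L v N e d he p)
  rw [cmPrincipalSeries_eq_normalizedInd] at hc ⊢
  haveI := locallyCompactSpace_cmBorelU L N v
  exact isConstituentOf_comap_normalizedInd (cmBorelTriple L N v) ((Representation.trivial ℂ ↥(torusU (conjLocal L (IsCMField.complexConj L) v) (cmLocalForm L N v)) ℂ).twist χ) e
    (mem_cmBorel_iff_of_coe_eq_diag_conj L v N e d he) hσ hc

/-! ## §4 `G = U(Φ₂)(L⁺_v)`: every local similitude of `Φ₂` permutes `JH(i_G(χ))` -/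

/-- **`diag(a, 1)` is a similitude of `Φ₂ = antidiag(1, 1)` with multiplier `a`** for a conjugation-fixed unit `a` of
`L ⊗ L⁺_v`: `ᵗ(diag(ā, 1)) Φ₂ diag(a, 1) = antidiag(ā, a) = a • Φ₂`. [cite: Rogawski1990, §11.1 p. 161] [cite: PlatonovRapinchuk1994, §2.3] -/
theorem formCongr_glDiagonal_two_eq_smul {a : LocalRing L v} (ha : IsUnit a)
    (haa : conjLocal L (IsCMField.complexConj L) v a = a) :
    formCongr (conjLocal L (IsCMField.complexConj L) v) (glDiagonal 2 (LocalRing L v) ![ha.unit, 1]) ((Matrix.of fun i j : Fin 2 => if i.val + j.val + 1 = 2 then (1 : L) else 0).map (algebraMap L (LocalRing L v))) =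
      a • (Matrix.of fun i j : Fin 2 => if i.val + j.val + 1 = 2 then (1 : L) else 0).map (algebraMap L (LocalRing L v)) := by
  rw [formCongr, coe_glDiagonal, Matrix.diagonal_map (map_zero _), Matrix.diagonal_transpose]
  ext i j
  rw [Matrix.mul_diagonal, Matrix.diagonal_mul, Matrix.smul_apply, Matrix.map_apply, Matrix.of_apply, smul_eq_mul]
  fin_cases i <;> fin_cases j <;>
    simp [haa, Matrix.cons_val_zero, Matrix.cons_val_one, IsUnit.unit_spec]

/-- **`JH(i_G(χ))` IS STABLE UNDER EVERY LOCAL SIMILITUDE OF `Φ₂`** (hypothesis (STAB) of the census cut of socket S4#B5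
`stub_R90_S4_H_lds`, PROVED).  For `G = U(Φ₂)(L⁺_v)`, a character `χ` of the diagonal torus, `T ∈ GL₂(L ⊗ L⁺_v)` with
`ᵗT̄ Φ₂ T = a Φ₂` (`a` a unit) and a constituent `c` of `i_G(χ) = cmPrincipalSeries L 2 v χ`, the pull-back `c ∘ Ad(T)`
(★ `IrrClass.comap` along ★ `cmDatumLocalCongr L v T`) is again a constituent of `i_G(χ)`.  PROOF: the multiplier `a` is
conjugation-fixed (★ `conjLocal_eq_self_of_formCongr_eq_smul_antidiag`); `D = diag(a, 1)` is a similitude with the SAME multiplier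
(`formCongr_glDiagonal_two_eq_smul`), so `T` and `D` pull back classes identically — they differ by `Ad(u)`, `u = T D⁻¹ ∈ U(Φ₂)(L⁺_v)`
(★ `comap_cmDatumLocalCongr_eq_of_eq_norm_mul`, R90-C131-p03, with `z = 1`); and `Ad(D)` preserves `JH(i_G(χ))` (§3).  «An L-packet on
`U(2)` is a `PGL₂(F)`-orbit»: the similitude action permutes the constituents of `i_G(χ)`. [cite: Rogawski1990, §11.1 p. 161; §12.1 p. 171]
[cite: BushnellHenniart2006, §1.1] [cite: PlatonovRapinchuk1994, §2.3] -/
theorem isConstituentOf_comap_cmDatumLocalCongr_cmPrincipalSeries (χ : ↥(torusU (conjLocal L (IsCMField.complexConj L) v) (cmLocalForm L 2 v)) →* ℂˣ)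
    (T : GL (Fin 2) (LocalRing L v)) (a : LocalRing L v) (ha : IsUnit a)
    (h : formCongr (conjLocal L (IsCMField.complexConj L) v) T ((Matrix.of fun i j : Fin 2 => if i.val + j.val + 1 = 2 then (1 : L) else 0).map (algebraMap L (LocalRing L v))) = a • (Matrix.of fun i j : Fin 2 => if i.val + j.val + 1 = 2 then (1 : L) else 0).map (algebraMap L (LocalRing L v)))
    {c : IrrClass ((cmDatum L 2 (Matrix.of fun i j : Fin 2 => if i.val + j.val + 1 = 2 then (1 : L) else 0)).Local v)}
    (hc : c.IsConstituentOf (cmPrincipalSeries L 2 v χ)) :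
    (IrrClass.comap (cmDatumLocalCongr L v T ha h) c).IsConstituentOf (cmPrincipalSeries L 2 v χ) := by
  have haa : conjLocal L (IsCMField.complexConj L) v a = a :=
    conjLocal_eq_self_of_formCongr_eq_smul_antidiag L two_ne_zero (antidiagOne_isHermitian L 2) v T h
  rw [← comap_cmDatumLocalCongr_eq_of_eq_norm_mul L v (glDiagonal 2 (LocalRing L v) ![ha.unit, 1]) T ha ha
    (formCongr_glDiagonal_two_eq_smul L v ha haa) h isUnit_one (by rw [map_one, one_mul, one_mul]) c]
  -- `Ad(diag(a, 1))` on `U(Φ₂)(L⁺_v)`, spelled over the subtype carrier `↥(unitaryGroupOfForm …)` (`cmDatum_Local_eq` is `rfl`);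
  -- definitionally the transport ★ `cmDatumLocalCongr L v (diag(a, 1)) …` (= ★ `localFormCongr` = this `restrictSubgroup` term)
  exact isConstituentOf_comap_cmPrincipalSeries_of_coe_eq_diag_conj L v 2 χ
    (ContinuousMulEquiv.restrictSubgroup (GLn.conjEquiv (glDiagonal 2 (LocalRing L v) ![ha.unit, 1]))
      (unitaryGroupOfForm (conjLocal L (IsCMField.complexConj L) v) (cmLocalForm L 2 v)) (unitaryGroupOfForm (conjLocal L (IsCMField.complexConj L) v) (cmLocalForm L 2 v))
      (conj_mem_local_iff_of_formCongr (IsCMField.complexConj L) v (glDiagonal 2 (LocalRing L v) ![ha.unit, 1]) ha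
        (formCongr_glDiagonal_two_eq_smul L v ha haa)))
    ![ha.unit, 1] (fun _ => rfl) (c := (c : IrrClass ↥(unitaryGroupOfForm (conjLocal L (IsCMField.complexConj L) v) (cmLocalForm L 2 v)))) hc

end CM

end Summit.HodgeConjecture.HodgeConjecture.R90.S4

end
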